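import Mathlib.MeasureTheory.Measure.Lebesgue.EqHaar
import Mathlib.MeasureTheory.Group.Integral
import Mathlib.Analysis.Calculus.FDeriv.Equiv
import Mathlib.Analysis.Calculus.ContDiff.Operations
import Mathlib.Topology.Algebra.Support
import HarnessLib

/-!
# Test functions under an invertible affine change of variables `y ↦ A(y − y₀)`

Bookkeeping used to move a Euclidean test function `f` (e.g. the cut-off bubble of
`AubinTestFunctionFour.lean`) to the linearised coordinates of a chart: for a continuous linear
automorphism `A` of a real normed space `E` and a base point `y₀`, the precomposition
`Φ = f ∘ (A(· − y₀))` is as smooth as `f` (`contDiff_comp_equiv_sub`), its differential is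
`dΦ_y = df_{A(y−y₀)} ∘ A` (`hasFDerivAt_comp_equiv_sub`, `abs_fderiv_comp_equiv_sub_le`), its
support is controlled by `‖A⁻¹‖` (`tsupport_comp_equiv_sub_subset`,
`hasCompactSupport_comp_equiv_sub`), and — for an additive Haar measure on a finite-dimensional
`E` — `∫ Φ(y) dy = |det A|⁻¹ ∫ f(z) dz` for EVERY `Φ` of this form, integrable or not
(`integral_comp_equiv_sub`; Mathlib's `map_linearMap_addHaar_eq_smul_addHaar` and translation
invariance). This is the elementary half of "reading a function in normalised coordinates"
in Aubin 1982, proof of Lemma 2.24 (`f̃(x) = f(exp_P x)`); the Riemannian half is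
`Geometry/Riemannian/ChartTestFunctions.lean`. Everything is proved; no definitions, no named
facts.

## References

* T. Aubin, *Nonlinear Analysis on Manifolds. Monge–Ampère Equations*, Grundlehren 252, Springer
  1982, Ch. 2, Lemma 2.24. [Aubin1982]
-/

noncomputable section

open Set Filter Function Metric Module MeasureTheory
open scoped Topology ContDiff

namespace Literature.Analysis.FunctionSpaces

variable {E : Type*} [NormedAddCommGroup E] [NormedSpace ℝ E]

/-! ### Precomposition with an invertible affine map `y ↦ A(y − y₀)` -/

section Affine

variable (A : E ≃L[ℝ] E) (y₀ : E)

/-- `y ↦ f(A(y − y₀))` is `C^n` if `f` is. [folklore] -/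
theorem contDiff_comp_equiv_sub {f : E → ℝ} {n : WithTop ℕ∞} (hf : ContDiff ℝ n f) :
    ContDiff ℝ n fun y => f (A (y - y₀)) :=
  hf.comp (A.contDiff.comp (contDiff_id.sub contDiff_const))

/-- Chain rule: `d(f ∘ (A(· − y₀)))_y w = df_{A(y−y₀)}(A w)`. [folklore] -/
theorem hasFDerivAt_comp_equiv_sub {f : E → ℝ} {y : E} (hf : DifferentiableAt ℝ f (A (y - y₀))) :
    HasFDerivAt (fun y => f (A (y - y₀))) ((fderiv ℝ f (A (y - y₀))).comp (A : E →L[ℝ] E)) y := by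
  have h1 : HasFDerivAt (fun y : E => A (y - y₀)) (A : E →L[ℝ] E) y := by
    have h := (A : E →L[ℝ] E).hasFDerivAt.comp y ((hasFDerivAt_id y).sub_const y₀)
    rwa [ContinuousLinearMap.comp_id] at h
  exact hf.hasFDerivAt.comp y h1

/-- `|d(f ∘ (A(· − y₀)))_y w| ≤ ‖df_{A(y−y₀)}‖ ‖A w‖`. [folklore] -/
theorem abs_fderiv_comp_equiv_sub_le {f : E → ℝ} {y : E} (hf : DifferentiableAt ℝ f (A (y - y₀)))
    (w : E) : |fderiv ℝ (fun y => f (A (y - y₀))) y w| ≤ ‖fderiv ℝ f (A (y - y₀))‖ * ‖A w‖ := by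
  rw [(hasFDerivAt_comp_equiv_sub A y₀ hf).fderiv, ContinuousLinearMap.comp_apply, ← Real.norm_eq_abs]
  exact ContinuousLinearMap.le_opNorm _ _

/-- `‖d(f ∘ (A(· − y₀)))_y‖ = ‖…‖`: the differential of the precomposition at `y` is the
differential of `f` at `A(y−y₀)` composed with `A` (as an equation between `fderiv`s; when `f`
is not differentiable there both sides need not agree, so differentiability is assumed).
[folklore] -/
theorem fderiv_comp_equiv_sub {f : E → ℝ} {y : E} (hf : DifferentiableAt ℝ f (A (y - y₀))) :
    fderiv ℝ (fun y => f (A (y - y₀))) y = (fderiv ℝ f (A (y - y₀))).comp (A : E →L[ℝ] E) :=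
  (hasFDerivAt_comp_equiv_sub A y₀ hf).fderiv

/-- **Support of the precomposition**: if `tsupport f ⊆ B(0, r)` then
`tsupport (f ∘ (A(· − y₀))) ⊆ B̄(y₀, ‖A⁻¹‖ r)`. [folklore] -/
theorem tsupport_comp_equiv_sub_subset {f : E → ℝ} {r : ℝ} (hf : tsupport f ⊆ ball 0 r) :
    tsupport (fun y => f (A (y - y₀))) ⊆ closedBall y₀ (‖(A.symm : E →L[ℝ] E)‖ * r) := by
  refine closure_minimal (fun y hy => ?_) isClosed_closedBall
  rw [mem_support] at hy
  have h1 : A (y - y₀) ∈ ball (0 : E) r := hf (subset_tsupport _ (mem_support.2 hy))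
  rw [mem_ball_zero_iff] at h1
  rw [mem_closedBall, dist_eq_norm]
  calc ‖y - y₀‖ = ‖(A.symm : E →L[ℝ] E) (A (y - y₀))‖ := by simp
    _ ≤ ‖(A.symm : E →L[ℝ] E)‖ * ‖A (y - y₀)‖ := ContinuousLinearMap.le_opNorm _ _
    _ ≤ ‖(A.symm : E →L[ℝ] E)‖ * r := mul_le_mul_of_nonneg_left h1.le (norm_nonneg _)

/-- The precomposition of a function supported in a ball has compact support (finite dimension).
[folklore] -/
theorem hasCompactSupport_comp_equiv_sub [ProperSpace E] {f : E → ℝ} {r : ℝ}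
    (hf : tsupport f ⊆ ball 0 r) : HasCompactSupport fun y => f (A (y - y₀)) :=
  (isCompact_closedBall y₀ _).of_isClosed_subset (isClosed_tsupport _)
    (tsupport_comp_equiv_sub_subset A y₀ hf)

end Affine

/-! ### Change of variables `z = A(y − y₀)` in integrals over a finite-dimensional space -/

section ChangeOfVariables

variable [MeasurableSpace E] [BorelSpace E] [FiniteDimensional ℝ E] (μ : Measure E)
  [μ.IsAddHaarMeasure] (A : E ≃L[ℝ] E) (y₀ : E)

/-- **Linear–affine change of variables**: for an additive Haar measure `μ` on a
finite-dimensional real space, an invertible linear `A` and any `Φ`,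
`∫ Φ(A(y − y₀)) dμ(y) = |det A|⁻¹ ∫ Φ dμ` (translation invariance and
`A_* μ = |det A|⁻¹ μ`, Mathlib's `map_linearMap_addHaar_eq_smul_addHaar`; no integrability
hypothesis, both sides vanishing together otherwise). [folklore] -/
theorem integral_comp_equiv_sub {F : Type*} [NormedAddCommGroup F] [NormedSpace ℝ F] (Φ : E → F) :
    ∫ y, Φ (A (y - y₀)) ∂μ = |LinearMap.det (A : E →ₗ[ℝ] E)|⁻¹ • ∫ z, Φ z ∂μ := by
  have h1 : ∫ y, Φ (A (y - y₀)) ∂μ = ∫ y, Φ (A y) ∂μ :=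
    integral_sub_right_eq_self (fun y => Φ (A y)) y₀
  rw [h1]
  have hdet : LinearMap.det (A : E →ₗ[ℝ] E) ≠ 0 := (LinearEquiv.isUnit_det' A.toLinearEquiv).ne_zero
  have hmap : Measure.map (A : E → E) μ = ENNReal.ofReal |(LinearMap.det (A : E →ₗ[ℝ] E))⁻¹| • μ :=
    Measure.map_linearMap_addHaar_eq_smul_addHaar μ hdet
  have h2 : ∫ y, Φ (A y) ∂μ = ∫ z, Φ z ∂(Measure.map (A : E → E) μ) := by
    have h := integral_map_equiv (μ := μ) A.toHomeomorph.toMeasurableEquiv Φ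
    exact h.symm
  rw [h2, hmap, MeasureTheory.integral_smul_measure, ENNReal.toReal_ofReal (abs_nonneg _), abs_inv]

end ChangeOfVariables

end Literature.Analysis.FunctionSpaces

end
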